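import Mathlib
import Literature.ModelTheory.ExponentialFields.TarskiSeidenbergProofs
import HarnessLib

/-!
# Quantifier elimination with complexity bounds (Renegar 1992) and algebraic boundaries of
# semialgebraic sets

Sources. J. Renegar, *On the computational complexity and geometry of the first-order theory of
the reals. Part I*, J. Symbolic Comput. 13 (1992) 255–299 [Renegar1992], Theorem 1.2 (p. 262–263;
held text `paper:doi-10-1016-s0747-7171-10-80003-3`, p0008–p0009): "THEOREM 1.2. There is a real
number model quantifier elimination method … The algorithm constructs a quantifier free formula of
the following simple form: `⋁_{i=1}^{I} ⋀_{j=1}^{J_i} (h_{ij}(y) Δ_{ij} 0)` where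
`I ≤ (md)^{2^{O(ω)} l ∏_k n_k}`, `J_i ≤ (md)^{2^{O(ω)} ∏_k n_k}`, the degree of `h_{ij}` is at most
`(md)^{2^{O(ω)} ∏_k n_k}`, `Δ_{ij}` is one of the standard relations" (`<, ≤, =, ≠, ≥, >`, eq. (1.2)),
for a prenex formula with `l ≥ 1` free variables `y`, `ω` quantifier blocks of sizes `n_1, …, n_ω`,
`m` atomic polynomial predicates of degree `≤ d`, `d ≥ 2` (standing assumptions, p. 258 and p. 262).
The ONE-BLOCK EXISTENTIAL case is restated verbatim as Theorem 4.15 of J. Gouveia, P. Parrilo,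
R. Thomas, *Lifts of convex sets and cone factorizations*, Math. OR 38 (2013) [GouveiaParriloThomas2013]
(held `paper:arxiv-1111.3164`, p0014) and as Theorem 5.11 of H. Fawzi, J. Gouveia, P. Parrilo,
R. Robinson, R. Thomas, *Positive semidefinite rank*, Math. Program. 153 (2015) [FawziEtAl2015]
(held `paper:arxiv-1407.4095`, p0016): "Given a formula of the form `∃ y ∈ ℝ^{m−n} : g_i(x,y) ≥ 0
∀ i = 1, …, s` where `x ∈ ℝⁿ` and `g_i ∈ ℝ[x,y]` are polynomials of degree at most `d`, there exists
a quantifier elimination method that produces a quantifier free formula of the form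
`⋁_{i=1}^{I} ⋀_{j=1}^{J_i} (h_{ij}(x) Δ_{ij} 0)` where `h_{ij} ∈ ℝ[x]`, `Δ_{ij} ∈ {>, ≥, =, ≠, ≤, <}`
such that `I ≤ (sd)^{K n (m−n)}`, `J_i ≤ (sd)^{K(m−n)}` and the degree of `h_{ij}` is at most
`(sd)^{K(m−n)}`, where `K` is a constant."

Contents.
* §1 (PROVED, [folklore]; the step "multiplying all of these polynomials together, we obtain a
  single polynomial … that vanishes on the boundary of `C`" of [FawziEtAl2015, p16] /
  [GouveiaParriloThomas2013, proof of Prop. 4.17]): if membership in `S ⊆ ℝ^σ` only depends on the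
  sign vector of a finite family of polynomials `q_i`, then `frontier S` lies in the zero set of
  the product `H` of the nonzero `q_i` — off that zero set all signs are locally constant, so
  membership is locally constant, which is impossible at a boundary point — and `H ≠ 0`,
  `deg H ≤ Σ deg q_i` (`exists_frontier_subset_zeroLocus_of_sign_determined`).
* §2 (PROVED): hence the boundary of every `k`-semialgebraic subset of `ℝ^ι` lies on a real
  algebraic hypersurface `{H = 0}`, `H ≠ 0` (`IsSemialgebraic.exists_frontier_subset_zeroLocus`, via
  the tree's sign-condition normal form `IsSemialgebraic.exists_eq_setOf_signVec_mem`).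
* §3 NAMED FACT `Renegar1992_qeExistentialBlock`: Renegar's Theorem 1.2 for one existential block,
  in the Gouveia–Parrilo–Thomas / FGPRT form quoted above, with Renegar's standing hypotheses made
  explicit (`n ≥ 1` free variables, `m ≥ 1` bound variables, `s ≥ 1` atoms, `d ≥ 2`); the six
  standard relations `Δ_{ij}` are encoded as the set of admissible signs `Δ_{ij} ⊆ {−1, 0, 1}`
  (`h Δ 0 ⟺ sign h(x) ∈ Δ`; allowing all eight subsets only weakens the assertion).
  TODO(general form): `ω` alternating blocks, arbitrary Boolean combinations of atoms, and the
  operation/bit-complexity bounds of [Renegar1992, Thm 1.1–1.2] are not vendored.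
* §4 (PROVED from §1 + §3): the consequence used for psd lifts
  ([FawziEtAl2015, Prop. 5.12]; `exists_frontier_polynomial_of_qe`): modulo the fact, the boundary of
  a coordinate projection `{x ∈ ℝⁿ : ∃ y ∈ ℝ^m, g_l(x,y) ≥ 0 ∀ l}` (`s` polynomials of degree
  `≤ d`) lies in the zero set of a nonzero polynomial of degree `≤ (sd)^{K(n+2)m}`.

NOT here: the singly-exponential algorithms themselves (Parts II–III), decision bounds (Thm 1.1),
Collins' CAD. The qualitative projection theorem (Tarski–Seidenberg) is the tree's
`Literature.ModelTheory.ExponentialFields.tarski_seidenberg_real_holds` (proved).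
-/

noncomputable section

open MvPolynomial Set Filter
open scoped Topology BigOperators

namespace Literature.AlgebraicGeometry.RealAlgebraic

/-! ### §1 Boundaries of sets determined by sign conditions -/

section SignDetermined

variable {σ : Type*}

/-- The sign of a polynomial is locally constant off its zero set: if `p(x) ≠ 0` then
`sign p(y) = sign p(x)` for all `y` near `x` (continuity of polynomial maps). [folklore] -/
private theorem eventually_sign_eval_eq (p : MvPolynomial σ ℝ) {x : σ → ℝ} (hx : eval x p ≠ 0) :
    ∀ᶠ y in 𝓝 x, SignType.sign (eval y p) = SignType.sign (eval x p) := by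
  rcases lt_or_gt_of_ne hx with h | h
  · have hmem : {y : σ → ℝ | eval y p < 0} ∈ 𝓝 x :=
      (isOpen_lt (MvPolynomial.continuous_eval p) continuous_const).mem_nhds h
    filter_upwards [hmem] with y hy
    rw [sign_neg hy, sign_neg h]
  · have hmem : {y : σ → ℝ | 0 < eval y p} ∈ 𝓝 x :=
      (isOpen_lt continuous_const (MvPolynomial.continuous_eval p)).mem_nhds h
    filter_upwards [hmem] with y hy
    rw [sign_pos hy, sign_pos h]

variable {ι : Type*} [Fintype ι]

/-- **Boundary points are zeros of the product of the describing polynomials.** If membership in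
`S ⊆ ℝ^σ` only depends on the sign vector `(sign q_i(x))_i` of a finite family of polynomials, then
off the zero set of `H = ∏_{q_i ≠ 0} q_i` every sign is locally constant, hence so is membership in
`S`; so no point with `H(x) ≠ 0` is a boundary point of `S`. ("Multiplying all of these polynomials
together, we obtain a single polynomial … that vanishes on the boundary of `C`.")
[cite: FawziEtAl2015, §5.2 after Thm 5.11 (p16)] -/
theorem frontier_subset_zeroLocus_prod_of_sign_determined [DecidableEq (MvPolynomial σ ℝ)]
    (q : ι → MvPolynomial σ ℝ) {S : Set (σ → ℝ)}
    (hS : ∀ x y : σ → ℝ, (∀ i, SignType.sign (eval x (q i)) = SignType.sign (eval y (q i))) →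
      (x ∈ S ↔ y ∈ S)) :
    frontier S ⊆ {x | eval x (∏ i ∈ Finset.univ.filter (fun i => q i ≠ 0), q i) = 0} := by
  intro x hx
  rw [Set.mem_setOf_eq]
  by_contra hne
  rw [map_prod] at hne
  have hne' : ∀ i ∈ Finset.univ.filter (fun i => q i ≠ 0), eval x (q i) ≠ 0 :=
    Finset.prod_ne_zero_iff.1 hne
  have hcl : x ∈ closure S := frontier_subset_closure hx
  have hint : x ∉ interior S := hx.2
  -- all signs are locally constant near `x`
  have hev : ∀ᶠ y in 𝓝 x, ∀ i, SignType.sign (eval y (q i)) = SignType.sign (eval x (q i)) := by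
    rw [Filter.eventually_all]
    intro i
    by_cases hi : q i = 0
    · exact Filter.Eventually.of_forall fun y => by simp [hi]
    · exact eventually_sign_eval_eq (q i) (hne' i (Finset.mem_filter.2 ⟨Finset.mem_univ _, hi⟩))
  have hiff : ∀ᶠ y in 𝓝 x, (y ∈ S ↔ x ∈ S) := hev.mono fun y hy => hS y x hy
  by_cases hxS : x ∈ S
  · exact hint (mem_interior_iff_mem_nhds.2 (hiff.mono fun y hy => hy.2 hxS))
  · have hc : Sᶜ ∈ 𝓝 x := hiff.mono fun y hy hyS => hxS (hy.1 hyS)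
    have hx' : x ∈ interior Sᶜ := mem_interior_iff_mem_nhds.2 hc
    rw [interior_compl] at hx'
    exact hx' hcl

/-- **A nonzero polynomial of controlled degree vanishing on the boundary.** Under the hypothesis
of `frontier_subset_zeroLocus_prod_of_sign_determined`, there is `H ≠ 0` with
`deg H ≤ Σ_i deg q_i` vanishing on `frontier S` (the product of the nonzero `q_i`; the empty product
`1` when `S ∈ {∅, ℝ^σ}` has empty boundary). [cite: FawziEtAl2015, §5.2 after Thm 5.11 (p16)] -/
theorem exists_frontier_subset_zeroLocus_of_sign_determined (q : ι → MvPolynomial σ ℝ)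
    {S : Set (σ → ℝ)}
    (hS : ∀ x y : σ → ℝ, (∀ i, SignType.sign (eval x (q i)) = SignType.sign (eval y (q i))) →
      (x ∈ S ↔ y ∈ S)) :
    ∃ H : MvPolynomial σ ℝ, H ≠ 0 ∧ H.totalDegree ≤ ∑ i, (q i).totalDegree ∧
      ∀ x ∈ frontier S, eval x H = 0 := by
  classical
  refine ⟨∏ i ∈ Finset.univ.filter (fun i => q i ≠ 0), q i, ?_, ?_, ?_⟩
  · exact Finset.prod_ne_zero_iff.2 fun i hi => (Finset.mem_filter.1 hi).2
  · calc (∏ i ∈ Finset.univ.filter (fun i => q i ≠ 0), q i).totalDegree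
        ≤ ∑ i ∈ Finset.univ.filter (fun i => q i ≠ 0), (q i).totalDegree :=
          totalDegree_finsetProd _ _
      _ ≤ ∑ i, (q i).totalDegree :=
          Finset.sum_le_sum_of_subset_of_nonneg (Finset.filter_subset _ _) fun _ _ _ => Nat.zero_le _
  · intro x hx
    exact frontier_subset_zeroLocus_prod_of_sign_determined q hS hx

end SignDetermined

/-! ### §2 The boundary of a semialgebraic set lies on an algebraic hypersurface -/

/-- **The boundary of a semialgebraic set lies on a hypersurface.** For every `k`-semialgebraic
`s ⊆ ℝ^ι` there is a nonzero real polynomial vanishing on `frontier s`: write `s` as a union of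
sign conditions on a finite family `Q` (the tree's `IsSemialgebraic.exists_eq_setOf_signVec_mem`) and
take the product of the nonzero members of `Q` — the observation "by construction, this polynomial
vanishes on the boundary of `C`" of the survey for a semialgebraic `C` given by a quantifier-free
formula. (Dot-notation extension of the tree's `Literature.ModelTheory.ExponentialFields.IsSemialgebraic`,
declared by absolute name.) [cite: FawziEtAl2015, §5.2 after Thm 5.11 (p16)] -/
theorem _root_.Literature.ModelTheory.ExponentialFields.IsSemialgebraic.exists_frontier_subset_zeroLocus
    {k : Type*} [CommRing k] [Algebra k ℝ] {ι : Type*} {s : Set (ι → ℝ)}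
    (hs : Literature.ModelTheory.ExponentialFields.IsSemialgebraic k s) :
    ∃ H : MvPolynomial ι ℝ, H ≠ 0 ∧ ∀ x ∈ frontier s, eval x H = 0 := by
  classical
  obtain ⟨Q, T, rfl⟩ := hs.exists_eq_setOf_signVec_mem
  have key : ∀ (x : ι → ℝ) (q : Q), eval x (MvPolynomial.map (algebraMap k ℝ) (q : MvPolynomial ι k))
      = aeval x (q : MvPolynomial ι k) := fun x q => by
    rw [MvPolynomial.eval_map, MvPolynomial.aeval_def]
  obtain ⟨H, hH0, -, hH⟩ := exists_frontier_subset_zeroLocus_of_sign_determined (σ := ι)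
    (fun q : Q => MvPolynomial.map (algebraMap k ℝ) (q : MvPolynomial ι k))
    (S := {x | (fun q : Q => SignType.sign (aeval x (q : MvPolynomial ι k))) ∈ T}) (by
      intro x y hxy
      simp only [Set.mem_setOf_eq]
      have hfun : (fun q : Q => SignType.sign (aeval x (q : MvPolynomial ι k))) =
          fun q : Q => SignType.sign (aeval y (q : MvPolynomial ι k)) := by
        funext q
        have h := hxy q
        rwa [key, key] at h
      rw [hfun])
  exact ⟨H, hH0, hH⟩

/-! ### §3 Renegar's quantifier elimination for one existential block (named fact) -/

/-- **Renegar's quantifier elimination with complexity bounds, one existential block**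
(Renegar 1992, Part I, Theorem 1.2 with `ω = 1`; restated as [GouveiaParriloThomas2013, Thm 4.15] and
[FawziEtAl2015, Thm 5.11], verbatim): "Given a formula of the form
`∃ y ∈ ℝ^{m} : g_i(x,y) ≥ 0 ∀ i = 1, …, s` where `x ∈ ℝⁿ` and `g_i ∈ ℝ[x,y]` are polynomials of
degree at most `d`, there exists a quantifier elimination method that produces a quantifier free
formula of the form `⋁_{i=1}^{I} ⋀_{j=1}^{J_i} (h_{ij}(x) Δ_{ij} 0)` where `h_{ij} ∈ ℝ[x]`,
`Δ_{ij} ∈ {>, ≥, =, ≠, ≤, <}` such that `I ≤ (sd)^{K n m}`, `J_i ≤ (sd)^{K m}` and the degree of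
`h_{ij}` is at most `(sd)^{K m}`, where `K` is a constant" (FGPRT write `m − n` for the number of
bound variables; here it is `m`). Renegar's standing assumptions are explicit hypotheses: at least
one free variable (`1 ≤ n`, "we assume that `l` … is at least one", p. 262), a nonempty block
(`1 ≤ m`), at least one atom (`1 ≤ s`) and `d ≥ 2` ("we assume that `d ≥ 2` is an upper bound on
the degrees", p. 258). A relation `Δ_{ij}` is encoded by its set of admissible signs
(`h Δ 0 ⟺ sign h(x) ∈ Δ`; `{1} ↔ >`, `{0,1} ↔ ≥`, `{0} ↔ =`, `{−1,1} ↔ ≠`, `{−1,0} ↔ ≤`,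
`{−1} ↔ <`), free and bound variables are the blocks `Fin.castAdd m`, `Fin.natAdd n` of
`Fin (n + m)` and a point `(x, y)` is `Fin.append x y`. Equivalence of formulae = equality of the
sets of satisfying `x`. TODO(general form): several alternating blocks, arbitrary Boolean matrices,
and the operation counts of [Renegar1992, Thm 1.2].
[cite: Renegar1992, Thm 1.2 (pp. 262–263)] [cite: FawziEtAl2015, Thm 5.11 (p16)] -/
def Renegar1992_qeExistentialBlock : Prop :=
  ∃ K : ℕ, ∀ (n m s d : ℕ), 1 ≤ n → 1 ≤ m → 1 ≤ s → 2 ≤ d →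
    ∀ g : Fin s → MvPolynomial (Fin (n + m)) ℝ, (∀ l, (g l).totalDegree ≤ d) →
      ∃ (I : ℕ) (J : Fin I → ℕ) (h : (i : Fin I) → Fin (J i) → MvPolynomial (Fin n) ℝ)
        (Δ : (i : Fin I) → Fin (J i) → Set SignType),
        I ≤ (s * d) ^ (K * (n * m)) ∧ (∀ i, J i ≤ (s * d) ^ (K * m)) ∧
          (∀ i j, (h i j).totalDegree ≤ (s * d) ^ (K * m)) ∧
          ∀ x : Fin n → ℝ,
            (∃ y : Fin m → ℝ, ∀ l, 0 ≤ eval (Fin.append x y) (g l)) ↔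
              ∃ i : Fin I, ∀ j : Fin (J i), SignType.sign (eval x (h i j)) ∈ Δ i j

/-! ### §4 Consequence: degree of the algebraic boundary of a projection -/

/-- **Boundary of a projected basic semialgebraic set, with a degree bound** (the use made of
Theorem 5.11 in [FawziEtAl2015, proof of Prop. 5.12] / [GouveiaParriloThomas2013, proof of
Prop. 4.17]: "the boundary of `C` is described by at most `(k²)^{K(m−n)(n+1)}` polynomials of
degree at most `(k²)^{K(m−n)}` … by multiplying all those polynomials together we get a polynomial
vanishing on the boundary"). Modulo `Renegar1992_qeExistentialBlock`: there is a constant `K` such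
that for `n, m, s ≥ 1`, `d ≥ 2` and `g_1, …, g_s ∈ ℝ[x,y]` of degree `≤ d`, the boundary of
`C = {x ∈ ℝⁿ : ∃ y ∈ ℝ^m, g_l(x,y) ≥ 0 ∀ l}` lies in the zero set of a nonzero polynomial of degree
`≤ I · max J_i · max deg h_{ij} ≤ (sd)^{K(n+2)m}`. [cite: FawziEtAl2015, Prop. 5.12 proof (p16)] -/
theorem exists_frontier_polynomial_of_qe (hqe : Renegar1992_qeExistentialBlock) :
    ∃ K : ℕ, ∀ (n m s d : ℕ), 1 ≤ n → 1 ≤ m → 1 ≤ s → 2 ≤ d →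
      ∀ g : Fin s → MvPolynomial (Fin (n + m)) ℝ, (∀ l, (g l).totalDegree ≤ d) →
        ∃ H : MvPolynomial (Fin n) ℝ, H ≠ 0 ∧ H.totalDegree ≤ (s * d) ^ (K * ((n + 2) * m)) ∧
          ∀ x ∈ frontier {x : Fin n → ℝ | ∃ y : Fin m → ℝ, ∀ l, 0 ≤ eval (Fin.append x y) (g l)},
            eval x H = 0 := by
  obtain ⟨K, hK⟩ := hqe
  refine ⟨K, fun n m s d hn hm hs hd g hg => ?_⟩
  obtain ⟨I, J, h, Δ, hI, hJ, hdeg, hmem⟩ := hK n m s d hn hm hs hd g hg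
  obtain ⟨H, hH0, hHdeg, hH⟩ := exists_frontier_subset_zeroLocus_of_sign_determined
    (fun p : (Σ i : Fin I, Fin (J i)) => h p.1 p.2)
    (S := {x : Fin n → ℝ | ∃ y : Fin m → ℝ, ∀ l, 0 ≤ eval (Fin.append x y) (g l)}) (by
      intro x y hxy
      simp only [Set.mem_setOf_eq]
      rw [hmem x, hmem y]
      have hs' : ∀ i j, SignType.sign (eval x (h i j)) = SignType.sign (eval y (h i j)) :=
        fun i j => hxy ⟨i, j⟩
      simp only [hs'])
  refine ⟨H, hH0, hHdeg.trans ?_, hH⟩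
  have hD : 0 < s * d := Nat.mul_pos hs (by omega)
  calc ∑ p : (Σ i : Fin I, Fin (J i)), (h p.1 p.2).totalDegree
      ≤ ∑ p : (Σ i : Fin I, Fin (J i)), (s * d) ^ (K * m) :=
        Finset.sum_le_sum fun p _ => hdeg p.1 p.2
    _ = (∑ i : Fin I, J i) * (s * d) ^ (K * m) := by
        rw [Finset.sum_const, smul_eq_mul, Finset.card_univ, Fintype.card_sigma]
        simp only [Fintype.card_fin]
    _ ≤ (∑ _i : Fin I, (s * d) ^ (K * m)) * (s * d) ^ (K * m) :=
        Nat.mul_le_mul_right _ (Finset.sum_le_sum fun i _ => hJ i)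
    _ = I * (s * d) ^ (K * m) * (s * d) ^ (K * m) := by
        rw [Finset.sum_const, smul_eq_mul, Finset.card_univ, Fintype.card_fin]
    _ ≤ (s * d) ^ (K * (n * m)) * (s * d) ^ (K * m) * (s * d) ^ (K * m) := by
        gcongr
    _ = (s * d) ^ (K * ((n + 2) * m)) := by
        rw [← pow_add, ← pow_add]
        congr 1
        ring

end Literature.AlgebraicGeometry.RealAlgebraic
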